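import Summits.BirchSwinnertonDyer.BirchSwinnertonDyer.Theorems.ByReductionTypeAtTwoTorsionEulerCharFact
import Literature.NumberTheory.EllipticCurves.Greenberg1999.Lemma46GammaInvariantsAuxPlace
import HarnessLib

set_option linter.dupNamespace false -- `…BirchSwinnertonDyer.BirchSwinnertonDyer…` is the cell's nested layout (D-0017)
set_option autoImplicit false

/-!
# Greenberg LNM 1716 Theorem 4.1 over `ℚ` WITH RATIONAL `p`-TORSION, TWO-SIDED, from KERNEL + ONE cite-tagged PRINT
# fact: the displayed binder `h46` RE-KEYED to `Greenberg1999.lemma46_gammaInvariants_auxPlace_rat` (part 14 of the series)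

Cell `bsd-2adic` (run/shared/lean/pub/bsd-2adic/), seat `bsd-2adic-tower-1` GEN 33; pen RC-461 («ONE new leaf `…TorsionEulerCharFactOfPrint`
re-keys `(h46 : <displayed>)` ↦ `(h46 : Greenberg1999.lemma46_gammaInvariants_auxPlace_rat)` by name»); the fact was typed by
`bsd-2adic-audit-2` GEN 65 (p720443, sheet «hG46aux @ 2»: PRINT-DERIVED at every prime incl. `2`, flag-free).
`--supports stmt-BirchSwinnertonDyer-19271` (helper). THEOREMS ONLY (no definition, no named fact, no `sorry`, no Summit restatement:
the fact is fed BY NAME into the displayed slots of part 13); closes no item; nothing booked; no display re-keyed (D-0152: the doors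
with the displayed `h46` stay; these are by-name twins); BSD is not proved by any of this.

R. Greenberg, *Iwasawa theory for elliptic curves*, LNM 1716 (1999), Thm. 4.1 (p. 102), Lemma 4.6 (p. 105), Lemma 4.7 (pp. 107–108).
With parts 1–13 (kernel) and the ONE Literature fact `lemma46_gammaInvariants_auxPlace_rat` (Lemma 4.6 special case over `ℚ`,
good ordinary `p`, cyclotomic `κ`, `S ⊇ bad ∪ {p}`, `v₀ ∉ S`):

* **`constantCoeff_mul_sq_eq_printed_of_print`** — `f(0)·#E(ℚ)(p)² = u·p^{ord_p ∏_ℓ c_ℓ}·(p^{ord_p #Ẽ(𝔽_p)})²·#Sel_{p^∞}(E/ℚ)`, `u ∈ ℤ_pˣ`,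
  EVERY good ordinary `p` (`2` included), ANY rational `p`-torsion;
* **`charValue_rankZero_of_print`** — the same in the exact `ℚ_p`-currency;
* **`twoAdicEulerCharRankZero_of_print : lemma46_gammaInvariants_auxPlace_rat → X5.O1.TwoAdicEulerCharRankZero W 0`** for EVERY
  globally minimal elliptic `W/ℚ` (rational `2`-torsion allowed) — the `hEC` binder of the X5.O1 α-go doors from ONE print fact;
* **`greenberg_charValue_rankZero_of_print : lemma46_gammaInvariants_auxPlace_rat → greenberg_charValue_rankZero`** — the named fact
  with > 600 importers DERIVED from a strictly smaller print input (on {`E(ℚ)[p] = 0`} it is unconditional since k4-p1).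

The non-split multiplicative displays keep their displayed `h46` (the fact's habitat is good ordinary; Lemma 4.6's multiplicative
range is not transcribed). HONEST FRAMING: `lemma46_gammaInvariants_auxPlace_rat` is a cite-tagged `def : Prop` (nothing asserted,
no `_holds`); the theorems here are CONDITIONAL on it and on nothing else unprinted. Closes no item; no summit statement is proved;
the Birch–Swinnerton-Dyer conjecture is NOT proved by any of this.

References: [GreenbergLNM1716] Thm. 4.1 (p. 102), §4 Lemma 4.6 (p. 105), Lemma 4.7 (pp. 107–108); [Kato2004Asterisque] Thm. 17.4 (1).
-/

noncomputable section

open scoped Classical NumberField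

open NumberField IsDedekindDomain Field

namespace Summit.BirchSwinnertonDyer.BirchSwinnertonDyer.Theorems.TorsionEulerChar

open Literature.NumberTheory.EllipticCurves Literature.NumberTheory.GaloisRepresentations
  WeierstrassCurve ZpExtension Literature.NumberTheory.EllipticCurves.IwasawaAlgebra
  Literature.NumberTheory.EllipticCurves.IwasawaDual
  Literature.NumberTheory.EllipticCurves.GreenbergVatsal2000 Literature.NumberTheory.EllipticCurves.GreenbergSelmer
  Literature.NumberTheory.EllipticCurves.Rank1Residual Summit.BirchSwinnertonDyer.Rank1Residual.X2
  Literature.NumberTheory.EllipticCurves.Greenberg1999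

/-! ## §1 The printed and `ℚ_p` currencies from the fact -/

/-- **Greenberg's Thm. 4.1 over `ℚ`, PRINTED SHAPE, TWO-SIDED, EVERY good ordinary `p` (`2` included), ANY rational `p`-torsion —
KERNEL + the ONE print fact `lemma46_gammaInvariants_auxPlace_rat`:** for `W/ℚ` globally minimal and elliptic with `GoodOrd W p`,
`κ` cyclotomic with topological generator `γ`, `D` a dual datum with `char X = (f)` and `Sel_{p^∞}(E/ℚ)` finite: `X` is finitely
generated `Λ`-torsion and **`f(0) · #E(ℚ)(p)² = u · p^{ord_p ∏_ℓ c_ℓ} · (p^{ord_p #Ẽ(𝔽_p)})² · #Sel_{p^∞}(E/ℚ)`, `u ∈ ℤ_pˣ`.**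
(Part 13 `…_of_lemma46` with the fact fed at `S = bad ∪ {p}`, `v₀ ∉ S` from `exists_finset_place`.)
[cite: GreenbergLNM1716, Thm. 4.1 (p. 102), §4 Lemmas 4.6–4.7 (pp. 105–108)] -/
theorem constantCoeff_mul_sq_eq_printed_of_print (h46 : lemma46_gammaInvariants_auxPlace_rat)
    (p : ℕ) [hp : Fact p.Prime] (W : WeierstrassCurve ℚ)
    [W.IsGloballyMinimal] [W.IsElliptic] (hgo : GoodOrd W p) (κ : ZpExtension ℚ p) (hκ : κ.IsCyclotomic)
    {γ : absoluteGaloisGroup ℚ} (hγ : κ.IsTopGenerator γ) (D : W.SelmerDualData κ γ) [Finite (W.selmerGroupPInfty p)]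
    (f : IwasawaAlgebra p) (hf : Module.charIdeal (IwasawaAlgebra p) D.X = Ideal.span {f}) :
    Module.Finite (IwasawaAlgebra p) D.X ∧ Module.IsTorsion (IwasawaAlgebra p) D.X ∧
      ∃ u : ℤ_[p]ˣ, PowerSeries.constantCoeff f *
          (Nat.card (AddCommGroup.primaryComponent W.toAffine.Point p) : ℤ_[p]) ^ 2 =
        (u : ℤ_[p]) * (p ^ padicValNat p W.tamagawaProduct : ℕ) * ((p ^ padicValNat p (W.reductionPointCount p)) ^ 2 : ℕ) *
          Nat.card (W.selmerGroupPInfty p) := by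
  have hord : IsOrdinaryAt W p := hgo
  obtain ⟨S, v₀, hS, hv₀⟩ := exists_finset_place W p
  exact constantCoeff_mul_sq_eq_printed_of_lemma46 p W hgo κ hκ hγ D v₀ (hS v₀ hv₀).1 (hS v₀ hv₀).2
    (h46 W p hord κ hκ S hS v₀ hv₀) f hf

/-- **The TWO-SIDED display in the EXACT `ℚ_p`-currency of `greenberg_charValue_rankZero`, from KERNEL + the ONE print fact:**
`∃ u ∈ ℤ_pˣ`, `fE(0) · #E(ℚ)(p)² = u · p^{ord_p ∏_ℓ c_ℓ} · #Ẽ(𝔽_p)(p)² · #Sel_{p^∞}(E/ℚ)` — NO hypothesis on `E(ℚ)[p]`, no `p ≠ 2`.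
[cite: GreenbergLNM1716, Thm. 4.1 (p. 102), §4 Lemmas 4.6–4.7 (pp. 105–108)] -/
theorem charValue_rankZero_of_print (h46 : lemma46_gammaInvariants_auxPlace_rat)
    (p : ℕ) [hp : Fact p.Prime] (W : WeierstrassCurve ℚ)
    [W.IsGloballyMinimal] [W.IsElliptic] (hgo : GoodOrd W p) (κ : ZpExtension ℚ p) (hκ : κ.IsCyclotomic)
    {γ : absoluteGaloisGroup ℚ} (hγ : κ.IsTopGenerator γ) (D : W.SelmerDualData κ γ) [Finite (W.selmerGroupPInfty p)]
    (fE : IwasawaAlgebra p) (hf : D.charIdeal = Ideal.span {fE}) :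
    ∃ u : ℤ_[p]ˣ,
      ((PowerSeries.constantCoeff fE : ℤ_[p]) : ℚ_[p]) *
          (Nat.card (AddCommGroup.primaryComponent W.toAffine.Point p) : ℚ_[p]) ^ 2 =
        ((u : ℤ_[p]) : ℚ_[p]) * (p : ℚ_[p]) ^ (padicValNat p W.tamagawaProduct) *
          (Nat.card (AddCommGroup.primaryComponent
            ((integralModelInt W).map (Int.castRingHom (ZMod p))).toAffine.Point p) : ℚ_[p]) ^ 2 *
          (Nat.card (W.selmerGroupPInfty p) : ℚ_[p]) := by
  have hord : IsOrdinaryAt W p := hgo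
  obtain ⟨S, v₀, hS, hv₀⟩ := exists_finset_place W p
  exact charValue_rankZero_of_lemma46 p W hgo κ hκ hγ D v₀ (hS v₀ hv₀).1 (hS v₀ hv₀).2
    (h46 W p hord κ hκ S hS v₀ hv₀) fE hf

/-! ## §2 The display at `p = 2` and the named fact, from KERNEL + ONE print fact -/

open Summit.BirchSwinnertonDyer.Rank1Residual.X5.O1 in
/-- **`hEC` from ONE print fact, rational `2`-torsion ALLOWED:** for EVERY globally minimal elliptic `W/ℚ`,
`Greenberg1999.lemma46_gammaInvariants_auxPlace_rat → X5.O1.TwoAdicEulerCharRankZero W 0` — Greenberg's rank-`0`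
Euler-characteristic formula at `2` in the tree's display shape (the `hEC` binder of the X5.O1 α-go doors; the display supplies
`IsOrdinaryAt W 2` itself). Parts 1–13 KERNEL + Lemma 4.6 (special case) PRINT. [cite: GreenbergLNM1716, Thm. 4.1 (p. 102), §4 Lemmas 4.6–4.7 (pp. 105–108)] -/
theorem twoAdicEulerCharRankZero_of_print (W : WeierstrassCurve ℚ) [W.IsElliptic] [W.IsGloballyMinimal]
    (h46 : lemma46_gammaInvariants_auxPlace_rat) : TwoAdicEulerCharRankZero W 0 :=
  twoAdicEulerCharRankZero_of_lemma46 W fun hgo κ hκ _ ↦ by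
    have hord : IsOrdinaryAt W 2 := hgo
    obtain ⟨S, v₀, hS, hv₀⟩ := exists_finset_place W 2
    exact ⟨v₀, (hS v₀ hv₀).1, (hS v₀ hv₀).2, h46 W 2 hord κ hκ S hS v₀ hv₀⟩

/-- **`greenberg_charValue_rankZero` from ONE strictly smaller print input:**
`Greenberg1999.lemma46_gammaInvariants_auxPlace_rat → greenberg_charValue_rankZero` — Greenberg's Thm. 4.1 over `ℚ` in rank `0`
at every odd good ordinary `p`, ANY rational `p`-torsion, is KERNEL (parts 1–13: Lemmas 4.2/4.3, Mazur control, Lemma 3.3/3.4 at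
`n = 0`, Lemma 4.7 with torsion, Cassels' count at `v₀`) modulo Lemma 4.6 (special case) alone.
[cite: GreenbergLNM1716, Thm. 4.1 (p. 102), §4 Lemmas 4.6–4.7 (pp. 105–108)] -/
theorem greenberg_charValue_rankZero_of_print (h46 : lemma46_gammaInvariants_auxPlace_rat) :
    greenberg_charValue_rankZero :=
  greenberg_charValue_rankZero_of_lemma46 fun W _ _ p _ hgo κ hκ _ ↦ by
    have hord : IsOrdinaryAt W p := hgo
    obtain ⟨S, v₀, hS, hv₀⟩ := exists_finset_place W p
    exact ⟨v₀, (hS v₀ hv₀).1, (hS v₀ hv₀).2, h46 W p hord κ hκ S hS v₀ hv₀⟩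

end Summit.BirchSwinnertonDyer.BirchSwinnertonDyer.Theorems.TorsionEulerChar

end
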